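import Summits.AtomisticToContinuum.HydrodynamicLimit.Theses.AntiMazurCoboundaries
import Literature.MathematicalPhysics.KineticTheory.HardSphereEulerProofs
import Summits.AtomisticToContinuum.HydrodynamicLimit.Theorems.JParityClosureOddContactSymmetryGibbsInvariance
import Summits.AtomisticToContinuum.HydrodynamicLimit.Theorems.CorrectorPressureDecay.Negative.Frame
import Literature.Probability.Divergences.FDivVariational
import Literature.Probability.Divergences.DonskerVaradhan

/-!
# One-body entropy budget for the symmetrised window-averaged one-body law (stub 2)

Helper file (`--supports stmt-AtomisticToContinuum-14135`) proving the registered stub `stub_oneBodyEntropyBudget` of the lead's skeleton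
`Cruxes/CorrectorPressureDecay/Lines/kinetic-entropy-collision-budget.lean` (line `kinetic-entropy-collision-budget`) of
the crux `Summit.AtomisticToContinuum.HydrodynamicLimit.Theses.AntiMazurCoboundaries.CorrectorPressureDecay`
(stmt-AtomisticToContinuum-14135, route `AntiMazurCoboundaries`). The statement is spelled over tree primitives exactly
as registered; see the skeleton for the objects it abbreviates (`discAvg`, `optimiser`, `windowOneBodyLaw`, `condKL`,
`fastDev`).

Proof (duality; no disintegration of `N`-body laws). Write `G_N` for the homogeneous Gibbs law, `γ` for the
standard Gaussian on `ℝ³`, `Π̄ = L`, `Π̄ˣ = L.fst`. (i) `L` is a probability law: total mass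
`((N+1)n)⁻¹ · (N+1)n` (`isProbabilityMeasure_avgSum`). (ii) If `KL(P‖G_N) = ∞` there is nothing to prove.
Otherwise, by the conditional Donsker–Varadhan bound `klDiv_fst_prod_le_of_forall` it suffices to show
`∫ g dL ≤ KL(P‖G_N)/(N+1)` for every bounded measurable `g` on `𝕋³ × ℝ³` with `∫ e^{g(x,·)} dγ = 1` for all
`x`. Put `H(z) = ∑ᵢ g(xᵢ, ṽᵢ)` (`ṽ = (v - u₀)/√θ`) and `h = n⁻¹ ∑ⱼ H ∘ Φ_{t_j}`; then
`∫ h dP = (N+1) ∫ g dL` (`integral_avgSum`), the Gibbs inequality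
(`Literature.Probability.Divergences.integral_le_toReal_klDiv_add_integral`) gives
`∫ h dP ≤ KL(P‖G_N) + ∫ (e^h - 1) dG_N`, and `∫ e^h dG_N ≤ 1` (`lintegral_exp_avg_le_one`: convexity of
`exp` in the time average, invariance `Φ_t # G_N = G_N` of
`measurePreserving_flow_localGibbsLaw_const`, and the factorisation `∫ ∏ᵢ e^{g(xᵢ,ṽᵢ)} dG_N = 1` of
`lintegral_prod_oneBody_eq_one`, i.e. under `G_N` the `ṽᵢ` are i.i.d. `γ` independent of the positions,
from the tree's disintegration `lintegral_localGibbsMeasure`). The Donsker–Varadhan bound itself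
(`Literature.Probability.Divergences.klDiv_le_of_forall_integral_le`: `∫ψ dμ ≤ K + log ∫ e^ψ dν` for all
bounded measurable `ψ` implies `KL(μ‖ν) ≤ K`, by truncation and Fatou; Kipnis–Landim 1999 A1 Thm. 8.3) and its
conditional form `Literature.Probability.Divergences.klDiv_fst_prod_le_of_forall` were split off into the tree
file `Literature/Probability/Divergences/DonskerVaradhan.lean`.
-/

noncomputable section

open MeasureTheory ProbabilityTheory InformationTheory Set Filter Topology
open scoped ENNReal

namespace Summit.AtomisticToContinuum.HydrodynamicLimit.Theorems.KineticEntropyCollisionBudget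

open Literature.MathematicalPhysics.KineticTheory (T3 V3 hsDiameter localGibbsLaw)
open Literature.Analysis.FluidPDE (HardSphereFlow Config)

/-! ## Averages of push-forwards -/

/-- The uniform average of the push-forwards of a probability measure under `(N+1)·n` measurable maps
(`1 ≤ n`) is a probability measure. [folklore] -/
theorem isProbabilityMeasure_avgSum {Ω β : Type*} [MeasurableSpace Ω] [MeasurableSpace β] {N n : ℕ}
    (hn : 1 ≤ n) (P : Measure Ω) [IsProbabilityMeasure P] (f : Fin (N + 1) → Fin n → Ω → β)
    (hf : ∀ i j, Measurable (f i j)) :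
    IsProbabilityMeasure ((((N + 1 : ℕ) : ℝ≥0∞)⁻¹ * ((n : ℝ≥0∞))⁻¹) •
      ∑ i : Fin (N + 1), ∑ j : Fin n, P.map (f i j)) := by
  refine ⟨?_⟩
  have h1 : ∀ i j, P.map (f i j) univ = 1 := fun i j => by
    rw [Measure.map_apply (hf i j) MeasurableSet.univ, preimage_univ, measure_univ]
  simp only [Measure.smul_apply, Measure.coe_finsetSum, Finset.sum_apply, h1, Finset.sum_const,
    Finset.card_univ, Fintype.card_fin, nsmul_eq_mul, mul_one, smul_eq_mul]
  have hN : ((N + 1 : ℕ) : ℝ≥0∞) ≠ 0 := by exact_mod_cast Nat.succ_ne_zero N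
  have hn0 : ((n : ℕ) : ℝ≥0∞) ≠ 0 := by exact_mod_cast (by omega : n ≠ 0)
  rw [mul_mul_mul_comm, ENNReal.inv_mul_cancel hN (ENNReal.natCast_ne_top _),
    ENNReal.inv_mul_cancel hn0 (ENNReal.natCast_ne_top _), one_mul]

/-- Integration of a bounded measurable function against the uniform average of push-forwards. [folklore] -/
theorem integral_avgSum {Ω β : Type*} [MeasurableSpace Ω] [MeasurableSpace β] {N n : ℕ}
    (P : Measure Ω) [IsProbabilityMeasure P] (f : Fin (N + 1) → Fin n → Ω → β)
    (hf : ∀ i j, Measurable (f i j)) {g : β → ℝ} (hg : Measurable g) {C : ℝ} (hC : ∀ x, |g x| ≤ C) :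
    ∫ x, g x ∂((((N + 1 : ℕ) : ℝ≥0∞)⁻¹ * ((n : ℝ≥0∞))⁻¹) •
        ∑ i : Fin (N + 1), ∑ j : Fin n, P.map (f i j)) =
      (((N + 1 : ℕ) : ℝ)⁻¹ * ((n : ℝ))⁻¹) * ∑ i : Fin (N + 1), ∑ j : Fin n, ∫ x, g (f i j x) ∂P := by
  have hgi : ∀ i j, Integrable g (P.map (f i j)) := fun i j =>
    Integrable.of_bound hg.aestronglyMeasurable C (ae_of_all _ fun x => by
      rw [Real.norm_eq_abs]; exact hC x)
  rw [integral_smul_measure, integral_finsetSum_measure, ENNReal.toReal_mul, ENNReal.toReal_inv,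
    ENNReal.toReal_inv, ENNReal.toReal_natCast, ENNReal.toReal_natCast, smul_eq_mul]
  · congr 1
    refine Finset.sum_congr rfl fun i _ => ?_
    rw [integral_finsetSum_measure fun j _ => hgi i j]
    refine Finset.sum_congr rfl fun j _ => ?_
    rw [integral_map (hf i j).aemeasurable hg.aestronglyMeasurable]
  · intro i _
    exact integrable_finsetSum_measure.2 fun j _ => hgi i j

/-! ## The Gibbs expectation of a product of normalised one-body factors -/

section Gibbs

open Literature.MathematicalPhysics.KineticTheory

/-- Tonelli on a finite product of copies of `μ`: a product of factors of unit `μ`-integral has unit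
integral. [folklore] -/
theorem lintegral_pi_prod_eq_one {ι : Type*} [Fintype ι] {E : Type*} [MeasurableSpace E]
    (μ : Measure E) [SigmaFinite μ] {f : ι → E → ℝ≥0∞} (hf : ∀ i, Measurable (f i))
    (h1 : ∀ i, ∫⁻ w, f i w ∂μ = 1) : ∫⁻ v, ∏ i, f i (v i) ∂(Measure.pi fun _ => μ) = 1 := by
  rw [lintegral_fintype_prod_eq_prod' _ hf]
  simp [h1]

/-- **Factorisation under the homogeneous Gibbs law.** Under `G_N = localGibbsMeasure σ a u₀ θ N`
(`σ ≤ 1/2`) the standardised velocities `ṽᵢ = (vᵢ - u₀)/√θ` are i.i.d. standard Gaussian and independent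
of the positions (`lintegral_localGibbsMeasure`, `velMeasure`, `gaussMeasure`): for measurable `F ≥ 0`
with `∫ F(x, v) γ(dv) = 1` for every `x`, `∫ ∏ᵢ F(xᵢ, ṽᵢ) dG_N = 1`. [folklore] -/
theorem lintegral_prod_oneBody_eq_one {a θ : ℝ} (ha : 0 < a) (hθ : 0 < θ) (u₀ : V3) {σ : ℝ}
    (hσ2 : σ ≤ 1 / 2) (N : ℕ) {F : T3 × V3 → ℝ≥0∞} (hF : Measurable F)
    (hF1 : ∀ x, ∫⁻ v, F (x, v) ∂(stdGaussian V3) = 1) :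
    ∫⁻ z, ∏ i, F ((z i).1, (Real.sqrt θ)⁻¹ • ((z i).2 - u₀))
      ∂(localGibbsMeasure σ (fun _ => a) (fun _ => u₀) (fun _ => θ) N) = 1 := by
  haveI := isProbabilityMeasure_localGibbsMeasure (a₀ := fun _ => a) (u₀ := fun _ => u₀)
    (θ₀ := fun _ => θ) continuous_const continuous_const continuous_const (fun _ => ha)
    (fun _ => hθ) hσ2 N
  have hsm : Measurable fun w : V3 => (Real.sqrt θ)⁻¹ • (w - u₀) := by fun_prop
  have hG : Measurable fun z : Config (N + 1) (Fin 3) T3 =>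
      ∏ i, F ((z i).1, (Real.sqrt θ)⁻¹ • ((z i).2 - u₀)) :=
    Finset.measurable_prod _ fun i _ =>
      hF.comp ((measurable_pi_apply i).fst.prodMk (hsm.comp (measurable_pi_apply i).snd))
  rw [lintegral_localGibbsMeasure continuous_const continuous_const continuous_const
    (fun _ => ha.le) (fun _ => hθ) σ N hG]
  simp only [zipConfig_apply]
  have hone : ∀ y : T3, ∫⁻ w, F (y, (Real.sqrt θ)⁻¹ • (w - u₀)) ∂(gaussMeasure u₀ θ) = 1 := by
    intro y
    rw [gaussMeasure, lintegral_map (show Measurable fun w : V3 => F (y, (Real.sqrt θ)⁻¹ • (w - u₀))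
      from hF.comp (measurable_const.prodMk hsm)) (measurable_gaussShift u₀ θ)]
    have hs : ∀ v : V3, (Real.sqrt θ)⁻¹ • (u₀ + Real.sqrt θ • v - u₀) = v := fun v => by
      rw [add_sub_cancel_left, smul_smul, inv_mul_cancel₀ (Real.sqrt_pos.2 hθ).ne', one_smul]
    simp_rw [hs]
    exact hF1 y
  have hinner : ∀ x : Fin (N + 1) → T3,
      ∫⁻ v, ∏ i, F (x i, (Real.sqrt θ)⁻¹ • (v i - u₀)) ∂velMeasure (fun _ => u₀) (fun _ => θ) x
        = 1 := fun x =>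
    lintegral_pi_prod_eq_one (gaussMeasure u₀ θ)
      (f := fun i w => F (x i, (Real.sqrt θ)⁻¹ • (w - u₀)))
      (fun i => hF.comp (measurable_const.prodMk hsm)) (fun i => hone (x i))
  simp_rw [hinner, mul_one]
  exact lintegral_posWeight_eq_one continuous_const continuous_const continuous_const
    (fun _ => ha.le) (fun _ => hθ) σ N

/-- **Exponential moment of a time average under an invariant law.** If each `T_j` preserves `G` and
`∫ e^H dG = 1`, then `∫ exp(n⁻¹ ∑_j H ∘ T_j) dG ≤ 1` (convexity of `exp` for the finite average, then
invariance term by term). [folklore] -/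
theorem lintegral_exp_avg_le_one {Ω : Type*} [MeasurableSpace Ω] {G : Measure Ω} {n : ℕ}
    (hn : 1 ≤ n) {T : Fin n → Ω → Ω} (hT : ∀ j, MeasurePreserving (T j) G G) {H : Ω → ℝ}
    (hH : Measurable H) (hH1 : ∫⁻ z, ENNReal.ofReal (Real.exp (H z)) ∂G = 1) :
    ∫⁻ z, ENNReal.ofReal (Real.exp ((n : ℝ)⁻¹ * ∑ j, H (T j z))) ∂G ≤ 1 := by
  have hn0 : (n : ℝ) ≠ 0 := by exact_mod_cast (by omega : n ≠ 0)
  have hnpos : (0 : ℝ) < (n : ℝ)⁻¹ := by positivity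
  -- Jensen for the finite average
  have hJ : ∀ z, Real.exp ((n : ℝ)⁻¹ * ∑ j, H (T j z)) ≤ ∑ j, (n : ℝ)⁻¹ * Real.exp (H (T j z)) := by
    intro z
    have := ConvexOn.map_sum_le convexOn_exp (t := Finset.univ) (w := fun _ : Fin n => (n : ℝ)⁻¹)
      (p := fun j => H (T j z)) (fun _ _ => hnpos.le)
      (by rw [Finset.sum_const, Finset.card_univ, Fintype.card_fin, nsmul_eq_mul,
        mul_inv_cancel₀ hn0]) (fun _ _ => mem_univ _)
    simpa only [smul_eq_mul, Finset.mul_sum] using this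
  have hem : Measurable fun z => ENNReal.ofReal (Real.exp (H z)) :=
    (Real.measurable_exp.comp hH).ennreal_ofReal
  have hj : ∀ j, ∫⁻ z, ENNReal.ofReal (Real.exp (H (T j z))) ∂G = 1 := fun j =>
    ((hT j).lintegral_comp (f := fun z => ENNReal.ofReal (Real.exp (H z))) hem).trans hH1
  calc ∫⁻ z, ENNReal.ofReal (Real.exp ((n : ℝ)⁻¹ * ∑ j, H (T j z))) ∂G
      ≤ ∫⁻ z, ∑ j, ENNReal.ofReal ((n : ℝ)⁻¹) * ENNReal.ofReal (Real.exp (H (T j z))) ∂G := by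
        refine lintegral_mono fun z => ?_
        refine (ENNReal.ofReal_le_ofReal (hJ z)).trans_eq ?_
        rw [ENNReal.ofReal_sum_of_nonneg fun j _ => (mul_pos hnpos (Real.exp_pos _)).le]
        exact Finset.sum_congr rfl fun j _ => ENNReal.ofReal_mul hnpos.le
    _ = ∑ j, ENNReal.ofReal ((n : ℝ)⁻¹) * ∫⁻ z, ENNReal.ofReal (Real.exp (H (T j z))) ∂G := by
        rw [lintegral_finsetSum' _ fun j _ =>
          (show Measurable fun z => ENNReal.ofReal ((n : ℝ)⁻¹) * ENNReal.ofReal (Real.exp (H (T j z)))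
            from (hem.comp (hT j).measurable).const_mul _).aemeasurable]
        exact Finset.sum_congr rfl fun j _ => lintegral_const_mul' _ _ ENNReal.ofReal_ne_top
    _ = 1 := by
        simp only [hj, mul_one, Finset.sum_const, Finset.card_univ, Fintype.card_fin, nsmul_eq_mul]
        rw [ENNReal.ofReal_inv_of_pos (by positivity), ENNReal.ofReal_natCast,
          ENNReal.mul_inv_cancel (by exact_mod_cast (by omega : n ≠ 0)) (ENNReal.natCast_ne_top _)]

end Gibbs

/-! ## The registered stub -/

/-- **Registered stub `stub_oneBodyEntropyBudget`** (line `kinetic-entropy-collision-budget`, crux stmt-AtomisticToContinuum-14135): for every probability law `P` on phase space the symmetrised window-averaged one-body law `Π̄(P)` is a probability law and `(N+1)·KL(Π̄ ‖ Π̄ˣ⊗γ) ≤ KL(P ‖ G_N)`. -/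
theorem stub_oneBodyEntropyBudget :
    ∀ (σ a θ : ℝ) (u₀ : V3), 0 < σ → σ ≤ 1 / 2 → 0 < a → 0 < θ →
      ∀ (N : ℕ) (Φ : HardSphereFlow (Literature.Analysis.FluidPDE.Torus.geometry (Fin 3)) (hsDiameter σ N) (N + 1)) (n : ℕ) (lag : ℝ), 1 ≤ n →
        ∀ P : Measure (Config (N + 1) (Fin 3) T3), IsProbabilityMeasure P →
        ∀ L : Measure (T3 × V3),
          L = (((N + 1 : ℕ) : ℝ≥0∞)⁻¹ * ((n : ℝ≥0∞))⁻¹) • ∑ i : Fin (N + 1), ∑ j : Fin n, (P).map (fun z => ((Φ.flow ((((j : ℕ) : ℝ) + 1) * lag) z i).1, (Real.sqrt θ)⁻¹ • ((Φ.flow ((((j : ℕ) : ℝ) + 1) * lag) z i).2 - u₀))) →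
          IsProbabilityMeasure L ∧
            ((N + 1 : ℕ) : ℝ≥0∞) * klDiv L (L.fst.prod (stdGaussian V3)) ≤ klDiv P (localGibbsLaw σ (fun _ => a) (fun _ => u₀) (fun _ => θ) N Φ) := by
  intro σ a θ u₀ _hσ hσ2 ha hθ N Φ n lag hn P hP L hL
  set G := localGibbsLaw σ (fun _ => a) (fun _ => u₀) (fun _ => θ) N Φ with hGdef
  haveI : IsProbabilityMeasure G :=
    Literature.MathematicalPhysics.KineticTheory.isProbabilityMeasure_localGibbsLaw continuous_const
      continuous_const continuous_const (fun _ => ha) (fun _ => hθ) hσ2 N Φ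
  -- the one-body observation maps `z ↦ (xᵢ(t_j), ṽᵢ(t_j))`
  set f : Fin (N + 1) → Fin n → Config (N + 1) (Fin 3) T3 → T3 × V3 := fun i j z =>
    ((Φ.flow ((((j : ℕ) : ℝ) + 1) * lag) z i).1,
      (Real.sqrt θ)⁻¹ • ((Φ.flow ((((j : ℕ) : ℝ) + 1) * lag) z i).2 - u₀)) with hf
  have hsm : Measurable fun p : T3 × V3 => (p.1, (Real.sqrt θ)⁻¹ • (p.2 - u₀)) := by fun_prop
  have hfm : ∀ i j, Measurable (f i j) := fun i j =>
    hsm.comp ((measurable_pi_apply i).comp (Φ.measurable_flow _))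
  have hLprob : IsProbabilityMeasure L := by
    rw [hL]
    exact isProbabilityMeasure_avgSum hn P f hfm
  refine ⟨hLprob, ?_⟩
  by_cases hfin : klDiv P G = ∞
  · rw [hfin]
    exact le_top
  have hN : (0 : ℝ) < (N + 1 : ℕ) := by exact_mod_cast Nat.succ_pos N
  -- the budget, real form: `KL(L ‖ L₁ ⊗ γ) ≤ KL(P ‖ G_N) / (N + 1)` by conditional Donsker–Varadhan
  have hbound : klDiv L (L.fst.prod (stdGaussian V3)) ≤
      ENNReal.ofReal ((klDiv P G).toReal / (N + 1 : ℕ)) := by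
    refine Literature.Probability.Divergences.klDiv_fst_prod_le_of_forall fun g C hgm hgC hg1 => ?_
    have hg1' : ∀ x, ∫⁻ v, ENNReal.ofReal (Real.exp (g (x, v))) ∂(stdGaussian V3) = 1 := by
      intro x
      have hi : Integrable (fun v => Real.exp (g (x, v))) (stdGaussian V3) :=
        Integrable.of_bound (Real.measurable_exp.comp (hgm.comp measurable_prodMk_left)).aestronglyMeasurable
          (Real.exp C) (ae_of_all _ fun v => by
            rw [Real.norm_eq_abs, abs_of_pos (Real.exp_pos _)]
            exact Real.exp_le_exp.2 ((le_abs_self _).trans (hgC _)))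
      rw [← ofReal_integral_eq_lintegral_ofReal hi (ae_of_all _ fun v => (Real.exp_pos _).le), hg1 x,
        ENNReal.ofReal_one]
    -- `H(z) = ∑ᵢ g(xᵢ, ṽᵢ)` has unit exponential Gibbs moment (factorisation)
    set H : Config (N + 1) (Fin 3) T3 → ℝ := fun z =>
      ∑ i, g ((z i).1, (Real.sqrt θ)⁻¹ • ((z i).2 - u₀)) with hH
    have hHm : Measurable H :=
      Finset.measurable_sum _ fun i _ => hgm.comp (hsm.comp (measurable_pi_apply i))
    have hH1 : ∫⁻ z, ENNReal.ofReal (Real.exp (H z)) ∂G = 1 := by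
      have hprod : ∀ z, ENNReal.ofReal (Real.exp (H z)) =
          ∏ i, ENNReal.ofReal (Real.exp (g ((z i).1, (Real.sqrt θ)⁻¹ • ((z i).2 - u₀)))) := fun z => by
        simp only [hH]
        rw [Real.exp_sum, ENNReal.ofReal_prod_of_nonneg fun i _ => (Real.exp_pos _).le]
      simp_rw [hprod]
      rw [hGdef, Literature.MathematicalPhysics.KineticTheory.localGibbsLaw_eq]
      exact lintegral_prod_oneBody_eq_one ha hθ u₀ hσ2 N (F := fun p => ENNReal.ofReal (Real.exp (g p)))
        (Real.measurable_exp.comp hgm).ennreal_ofReal hg1'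
    -- the Gibbs test function `h = n⁻¹ ∑ⱼ H ∘ Φ_{t_j}`
    set h : Config (N + 1) (Fin 3) T3 → ℝ := fun z =>
      (n : ℝ)⁻¹ * ∑ j : Fin n, H (Φ.flow ((((j : ℕ) : ℝ) + 1) * lag) z) with hh
    have hhm : Measurable h :=
      measurable_const.mul (Finset.measurable_sum _ fun j _ => hHm.comp (Φ.measurable_flow _))
    have hHb : ∀ z, |H z| ≤ (N + 1 : ℕ) * C := fun z =>
      calc |H z| ≤ ∑ i, |g ((z i).1, (Real.sqrt θ)⁻¹ • ((z i).2 - u₀))| := Finset.abs_sum_le_sum_abs _ _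
        _ ≤ ∑ _i : Fin (N + 1), C := Finset.sum_le_sum fun i _ => hgC _
        _ = (N + 1 : ℕ) * C := by
            rw [Finset.sum_const, Finset.card_univ, Fintype.card_fin, nsmul_eq_mul]
    have hn0 : (0 : ℝ) < n := by exact_mod_cast hn
    have hhb : ∀ z, |h z| ≤ (N + 1 : ℕ) * C := fun z =>
      calc |h z| = (n : ℝ)⁻¹ * |∑ j : Fin n, H (Φ.flow ((((j : ℕ) : ℝ) + 1) * lag) z)| := by
            rw [hh, abs_mul, abs_of_pos (inv_pos.2 hn0)]
        _ ≤ (n : ℝ)⁻¹ * ∑ _j : Fin n, ((N + 1 : ℕ) * C) :=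
            mul_le_mul_of_nonneg_left ((Finset.abs_sum_le_sum_abs _ _).trans
              (Finset.sum_le_sum fun j _ => hHb _)) (inv_pos.2 hn0).le
        _ = (N + 1 : ℕ) * C := by
            rw [Finset.sum_const, Finset.card_univ, Fintype.card_fin, nsmul_eq_mul, ← mul_assoc,
              inv_mul_cancel₀ hn0.ne', one_mul]
    have hhi : Integrable h P := Integrable.of_bound hhm.aestronglyMeasurable _
      (ae_of_all _ fun z => by rw [Real.norm_eq_abs]; exact hhb z)
    have hehi : Integrable (fun z => Real.exp (h z)) G :=
      Integrable.of_bound (Real.measurable_exp.comp hhm).aestronglyMeasurable (Real.exp ((N + 1 : ℕ) * C))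
        (ae_of_all _ fun z => by
          rw [Real.norm_eq_abs, abs_of_pos (Real.exp_pos _)]
          exact Real.exp_le_exp.2 ((le_abs_self _).trans (hhb z)))
    -- Gibbs inequality `∫ h dP ≤ KL(P‖G) + ∫ (e^h - 1) dG` and `∫ e^h dG ≤ 1` (Jensen + invariance)
    have hGibbs := Literature.Probability.Divergences.integral_le_toReal_klDiv_add_integral hfin hhi hehi
    have hle1 : ∫⁻ z, ENNReal.ofReal (Real.exp (h z)) ∂G ≤ 1 :=
      lintegral_exp_avg_le_one hn (fun j => measurePreserving_flow_localGibbsLaw_const σ a θ u₀ N Φ _)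
        hHm hH1
    have hexp : ∫ z, Real.exp (h z) ∂G ≤ 1 := by
      rw [integral_eq_lintegral_of_nonneg_ae (ae_of_all _ fun z => (Real.exp_pos _).le)
        (Real.measurable_exp.comp hhm).aestronglyMeasurable]
      exact ENNReal.toReal_le_of_le_ofReal zero_le_one (by rwa [ENNReal.ofReal_one])
    have hsub1 : ∫ z, (Real.exp (h z) - 1) ∂G = ∫ z, Real.exp (h z) ∂G - 1 := by
      rw [integral_sub hehi (integrable_const 1), integral_const, smul_eq_mul, probReal_univ, one_mul]
    -- `∫ h dP = (N + 1) ∫ g dL`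
    have hgi : ∀ i j, Integrable (fun z => g (f i j z)) P := fun i j =>
      Integrable.of_bound (hgm.comp (hfm i j)).aestronglyMeasurable C
        (ae_of_all _ fun z => by rw [Real.norm_eq_abs]; exact hgC _)
    have hhP : ∫ z, h z ∂P = (n : ℝ)⁻¹ * ∑ j : Fin n, ∑ i : Fin (N + 1), ∫ z, g (f i j z) ∂P := by
      rw [hh, integral_const_mul, integral_finsetSum _ fun j _ => integrable_finsetSum _ fun i _ => hgi i j]
      congr 1
      refine Finset.sum_congr rfl fun j _ => ?_
      exact integral_finsetSum _ fun i _ => hgi i j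
    have hgL : ∫ p, g p ∂L = (((N + 1 : ℕ) : ℝ)⁻¹ * ((n : ℝ))⁻¹) *
        ∑ i : Fin (N + 1), ∑ j : Fin n, ∫ z, g (f i j z) ∂P := by
      rw [hL]
      exact integral_avgSum P f hfm hgm hgC
    have hkey : ((N + 1 : ℕ) : ℝ) * ∫ p, g p ∂L = ∫ z, h z ∂P := by
      rw [hgL, hhP, Finset.sum_comm, ← mul_assoc, ← mul_assoc, mul_inv_cancel₀ hN.ne', one_mul]
    rw [le_div_iff₀ hN, mul_comm, hkey]
    linarith
  calc ((N + 1 : ℕ) : ℝ≥0∞) * klDiv L (L.fst.prod (stdGaussian V3))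
      ≤ ((N + 1 : ℕ) : ℝ≥0∞) * ENNReal.ofReal ((klDiv P G).toReal / (N + 1 : ℕ)) :=
        by gcongr
    _ = klDiv P G := by
        rw [ENNReal.ofReal_div_of_pos hN, ENNReal.ofReal_natCast, ENNReal.ofReal_toReal hfin,
          ENNReal.mul_div_cancel (by exact_mod_cast Nat.succ_ne_zero N) (ENNReal.natCast_ne_top _)]

end Summit.AtomisticToContinuum.HydrodynamicLimit.Theorems.KineticEntropyCollisionBudget

end
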